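import Mathlib

/-!
# Faithful pullback-preserving functors embed subobject lattices (solo-blind s69)

Kernel certificate of the category-theoretic half (T3) of LEMMA T of the notes
`paper/inj-sectors.md` §3 (session s68), used there in THEOREM Inj_𝒮 (b)–(c): two subobjects of an
effective Nori motive with the same Betti realisation are EQUAL, because the fibre functor is
faithful and exact on an abelian (hence balanced) category.  The general statement certified here:

* `le_of_map_comm` — if `F : C ⥤ D` is faithful, `C` is balanced, and `F` preserves the pullback
  `P ×_X Q` of two subobjects `P Q : Subobject X`, then any morphism `F P ⟶ F Q` over `F X` forces
  `P ≤ Q`.  Proof: `F` of the (mono) projection `P ×_X Q ⟶ P` acquires a section from the universal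
  property of the image pullback, so it is (split) epi; a faithful functor reflects epimorphisms;
  mono + epi is iso in a balanced category; compose the inverse with the second projection.
* `map_le_map_iff`, `mk_map_arrow_injective`, `subobjectEmbedding` — hence
  `P ↦ Subobject.mk (F.map P.arrow)` is an ORDER EMBEDDING `Subobject X ↪o Subobject (F.obj X)`
  whenever `C` has pullbacks, is balanced, and `F` is faithful and preserves pullbacks; in
  particular (`subobjectEmbeddingOfAbelian`) for every faithful functor preserving finite limits
  out of an abelian category — e.g. an exact faithful fibre functor, or the localisation
  `MM^eff_Nori → MM_Nori` of the notes.
* `full_of_comp_faithful'` — the other half of (T3), which is Mathlib's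
  `CategoryTheory.Functor.Full.of_comp_faithful`, restated for the record.

No fullness of `F` is assumed anywhere: the point of (T3) is that INJECTIVITY on subobjects is free,
while SURJECTIVITY (every subobject of `F X` comes from `X`) is the open statement `Inj` of the notes.
Bearing on the summit statement: none directly (infrastructure for the paper-level LEMMA T).
-/

open CategoryTheory CategoryTheory.Limits

namespace Summit.KontsevichZagierPeriods.KontsevichZagierPeriods.Theorems
namespace SoloBlind
namespace SubobjectTransfer

universe v₁ v₂ u₁ u₂

variable {C : Type u₁} [Category.{v₁} C] {D : Type u₂} [Category.{v₂} D] (F : C ⥤ D)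

/-- (T3, injectivity half, one pullback at a time.)  Let `F` be faithful, `C` balanced, and let `F`
preserve the pullback of the two subobjects `P, Q` of `X`.  If `F P` maps to `F Q` over `F X`, then
`P ≤ Q`. -/
theorem le_of_map_comm [F.Faithful] [Balanced C] {X : C} {P Q : Subobject X}
    [HasPullback P.arrow Q.arrow] [PreservesLimit (cospan P.arrow Q.arrow) F]
    (h : F.obj (P : C) ⟶ F.obj (Q : C)) (w : h ≫ F.map Q.arrow = F.map P.arrow) : P ≤ Q := by
  have hl := isLimitOfHasPullbackOfPreservesLimit F P.arrow Q.arrow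
  obtain ⟨s, hs₁, -⟩ := PullbackCone.IsLimit.lift' hl (𝟙 _) h (by simp [w])
  simp only [PullbackCone.mk_fst] at hs₁
  have hepiF : Epi (F.map (pullback.fst P.arrow Q.arrow)) := epi_of_epi_fac hs₁
  have hepi : Epi (pullback.fst P.arrow Q.arrow) := F.epi_of_epi_map hepiF
  have : IsIso (pullback.fst P.arrow Q.arrow) := isIso_of_mono_of_epi _
  refine Subobject.le_of_comm (inv (pullback.fst P.arrow Q.arrow) ≫ pullback.snd P.arrow Q.arrow) ?_
  rw [Category.assoc, ← pullback.condition, IsIso.inv_hom_id_assoc]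

/-- Conversely (trivially) `P ≤ Q` gives a morphism `F P ⟶ F Q` over `F X`. -/
theorem map_comm_of_le {X : C} {P Q : Subobject X} (hPQ : P ≤ Q) :
    F.map (Subobject.ofLE P Q hPQ) ≫ F.map Q.arrow = F.map P.arrow := by
  rw [← F.map_comp, Subobject.ofLE_arrow]

section pullbacks

variable [HasPullbacks C] [Balanced C] [F.Faithful] [PreservesLimitsOfShape WalkingCospan F]

/-- With all pullbacks available and preserved: `mk (F P.arrow) ≤ mk (F Q.arrow) ↔ P ≤ Q`. -/
theorem map_le_map_iff {X : C} (P Q : Subobject X) :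
    Subobject.mk (F.map P.arrow) ≤ Subobject.mk (F.map Q.arrow) ↔ P ≤ Q := by
  constructor
  · intro hle
    exact le_of_map_comm F (Subobject.ofMkLEMk _ _ hle) (Subobject.ofMkLEMk_comp hle)
  · intro hPQ
    exact Subobject.mk_le_mk_of_comm (F.map (Subobject.ofLE P Q hPQ)) (map_comm_of_le F hPQ)

/-- (T3, injectivity half.)  A faithful pullback-preserving functor out of a balanced category with
pullbacks is injective on subobjects: `P ↦ mk (F.map P.arrow)` is injective on `Subobject X`. -/
theorem mk_map_arrow_injective (X : C) :
    Function.Injective fun P : Subobject X => Subobject.mk (F.map P.arrow) := by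
  intro P Q hPQ
  exact le_antisymm ((map_le_map_iff F P Q).1 (le_of_eq hPQ))
    ((map_le_map_iff F Q P).1 (le_of_eq hPQ.symm))

/-- The same packaged as an order embedding `Subobject X ↪o Subobject (F.obj X)`. -/
noncomputable def subobjectEmbedding (X : C) : Subobject X ↪o Subobject (F.obj X) :=
  OrderEmbedding.ofMapLEIff (fun P : Subobject X => Subobject.mk (F.map P.arrow))
    (fun P Q => map_le_map_iff F P Q)

/-- The embedding sends `P` to `mk (F.map P.arrow)`. -/
theorem subobjectEmbedding_apply (X : C) (P : Subobject X) :
    subobjectEmbedding F X P = Subobject.mk (F.map P.arrow) := rfl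

/-- Two subobjects with isomorphic images OVER `F X` are equal. -/
theorem eq_of_map_iso {X : C} {P Q : Subobject X} (e : F.obj (P : C) ≅ F.obj (Q : C))
    (w : e.hom ≫ F.map Q.arrow = F.map P.arrow) : P = Q := by
  apply mk_map_arrow_injective F X
  exact Subobject.mk_eq_mk_of_comm _ _ e w

end pullbacks

/-- The case used in the notes: a faithful functor preserving finite limits (e.g. exact) out of an
ABELIAN category embeds every subobject lattice.  (Abelian ⟹ balanced with pullbacks; finite
limits ⟹ pullbacks.) -/
noncomputable def subobjectEmbeddingOfAbelian [Abelian C] [F.Faithful] [PreservesFiniteLimits F]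
    (X : C) : Subobject X ↪o Subobject (F.obj X) :=
  subobjectEmbedding F X

/-- In the abelian case: equal images in `Subobject (F X)` ⟹ equal subobjects. -/
theorem mk_map_arrow_injective_of_abelian [Abelian C] [F.Faithful] [PreservesFiniteLimits F]
    (X : C) : Function.Injective fun P : Subobject X => Subobject.mk (F.map P.arrow) :=
  mk_map_arrow_injective F X

/-- (T3, fullness half — Mathlib's `Functor.Full.of_comp_faithful`, restated.)  If `Φ ⋙ G` is full
and `G` is faithful then `Φ` is full: fullness of the localisation `EHM_𝒮 → MM` in the notes is
tested after composing with the (faithful) realisation. -/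
theorem full_of_comp_faithful' {E : Type*} [Category E] (Φ : C ⥤ D) (G : D ⥤ E)
    [(Φ ⋙ G).Full] [G.Faithful] : Φ.Full :=
  Functor.Full.of_comp_faithful Φ G

end SubobjectTransfer
end SoloBlind
end Summit.KontsevichZagierPeriods.KontsevichZagierPeriods.Theorems
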